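import Literature.AlgebraicGeometry.Resolution.DerivativeIdealsLocalization
import Literature.RingTheory.MvPolynomial.RuppertReducibleProofs
import Mathlib.Algebra.MvPolynomial.PDeriv
import Mathlib.Algebra.MvPolynomial.Derivation
import Mathlib.RingTheory.Derivation.Lie
import Mathlib.RingTheory.Polynomial.UniqueFactorization
import Mathlib.RingTheory.Localization.FractionRing
import Mathlib.RingTheory.Ideal.Quotient.Operations
import HarnessLib

/-!
# The function field of an irreducible hypersurface and its tangent derivations

Topic `Literature/RingTheory/MvPolynomial`. Everything in this file is PROVED (definitions with
bodies and their API); it is the commutative-algebra foundation for the algebraic treatment of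
the local differential geometry of a surface `{f = 0} ⊆ K³` through its function field
`K(S) = Frac(K[X₀,X₁,X₂]/(f))` — the setting in which the Monge–Salmon–Cayley theorem
("a surface all of whose points carry a triple tangent line is ruled", [Kollar2015, Thm. 13])
becomes a statement about two commuting derivations of a field.

For a field `K` and an irreducible `f ∈ K[σ]` (`[Fact (Irreducible f)]`):

* `Hypersurface.CoordRing f = K[σ] ⧸ (f)` (an integral domain) and the function field
  `Hypersurface.FnField f = Frac(CoordRing f)`; the structure map `toFn f : K[σ] →ₐ[K] FnField f`
  with `toFn_eq_zero_iff : toFn f g = 0 ↔ f ∣ g`.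
* `derivFn D hD` — a `K`-derivation `D` of `K[σ]` with `f ∣ D f` ("tangent to the
  hypersurface") descends to `CoordRing f` (`Derivation.liftOfSurjective`) and extends to the
  function field (`exists_derivation_extend_of_isLocalization`); `derivFn_toFn : derivFn D hD
  (toFn f g) = toFn f (D g)`; two derivations of `FnField f` agreeing on the coordinate functions
  agree (`derivation_eq_of_forall_X`).
* For `σ = Fin 3` and `∂₂ f ∉ (f)`: the **graph derivations** `Hypersurface.gD f a`
  (`a = 0, 1`), `gD f a = (∂₂f · ∂ₐ - ∂ₐf · ∂₂) / ∂₂f` — the derivations `∂/∂x₀`, `∂/∂x₁` of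
  `K(S)` regarded as a (separable) extension of `K(x₀, x₁)`, i.e. differentiation "along the
  graph `x₂ = z(x₀, x₁)`": `gD_toFn` (chain rule
  `gD a (g) = ∂ₐg + ∂₂g · gD a (x₂)`), `gD_X_self`, `gD_X_of_ne`, `gD_X_two`
  (`gD a (x₂) = -∂ₐf/∂₂f`), and **commutation** `gD_comm : gD 0 (gD 1 u) = gD 1 (gD 0 u)`
  (symmetry of mixed partials, `pderiv_pderiv_comm`).

## References
* [Kollar2015] J. Kollár, *Szemerédi–Trotter-type theorems in dimension 3*, Adv. Math. 271
  (2015), §6 (the analytic sketch of Monge–Salmon–Cayley which this algebra is meant to replace).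
* Standard commutative algebra (derivations of quotients and localizations). [folklore]
-/

namespace Literature.RingTheory.MvPolynomial

open _root_.MvPolynomial

namespace Hypersurface

variable {K : Type*} [Field K] {σ : Type*}

/-! ### Coordinate ring and function field -/

/-- The coordinate ring `K[σ] ⧸ (f)` of the hypersurface `{f = 0}`. [folklore] -/
abbrev CoordRing (f : MvPolynomial σ K) : Type _ := MvPolynomial σ K ⧸ Ideal.span {f}

/-- For irreducible `f` the coordinate ring is an integral domain. [folklore] -/
instance isDomain_coordRing (f : MvPolynomial σ K) [hf : Fact (Irreducible f)] :
    IsDomain (CoordRing f) := by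
  rw [Ideal.Quotient.isDomain_iff_prime, Ideal.span_singleton_prime hf.out.ne_zero]
  exact hf.out.prime

/-- The function field `Frac(K[σ] ⧸ (f))` of the irreducible hypersurface `{f = 0}`.
[folklore] -/
abbrev FnField (f : MvPolynomial σ K) [Fact (Irreducible f)] : Type _ := FractionRing (CoordRing f)

section Basic

variable (f : MvPolynomial σ K) [Fact (Irreducible f)]

/-- The structure map `K[σ] → K(S)`, `g ↦ ḡ`. [folklore] -/
noncomputable def toFn : MvPolynomial σ K →ₐ[K] FnField f :=
  (IsScalarTower.toAlgHom K (CoordRing f) (FnField f)).comp (Ideal.Quotient.mkₐ K (Ideal.span {f}))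

/-- Unfolding `toFn`. [folklore] -/
theorem toFn_apply (g : MvPolynomial σ K) :
    toFn f g = algebraMap (CoordRing f) (FnField f) (Ideal.Quotient.mk (Ideal.span {f}) g) := rfl

/-- `ḡ = 0` in the function field iff `f ∣ g`. [folklore] -/
theorem toFn_eq_zero_iff {g : MvPolynomial σ K} : toFn f g = 0 ↔ f ∣ g := by
  rw [toFn_apply, IsFractionRing.to_map_eq_zero_iff, Ideal.Quotient.eq_zero_iff_mem,
    Ideal.mem_span_singleton]

/-- `f̄ = 0`. [folklore] -/
theorem toFn_self : toFn f f = 0 := (toFn_eq_zero_iff f).2 dvd_rfl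

/-- A non-zero partial derivative of `f` is non-zero in the function field (`f` cannot divide a
non-zero polynomial of smaller degree). [folklore] -/
theorem toFn_pderiv_ne_zero {i : σ} (hi : pderiv i f ≠ 0) : toFn f (pderiv i f) ≠ 0 := by
  have hf : Irreducible f := Fact.out
  rw [Ne, toFn_eq_zero_iff]
  intro hdvd
  have h1 := totalDegree_le_of_dvd_of_isDomain hdvd hi
  have h2 := Ruppert.totalDegree_pderiv_le i f
  -- `f` is not constant
  have hpos : 0 < f.totalDegree := by
    by_contra h0
    push Not at h0
    have hfC : f = C (coeff 0 f) := totalDegree_eq_zero_iff_eq_C.1 (Nat.le_zero.1 h0)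
    refine hf.not_isUnit ?_
    rw [hfC]
    refine MvPolynomial.isUnit_iff_eq_C_of_isReduced.2 ⟨coeff 0 f, ?_, rfl⟩
    exact isUnit_iff_ne_zero.2 fun hc => hf.ne_zero (by rw [hfC, hc, C_0])
  omega

end Basic

/-! ### Tangent derivations descend to the coordinate ring and extend to the function field -/

section Derivations

variable {f : MvPolynomial σ K} [Fact (Irreducible f)]

/-- A `K`-derivation `D` of `K[σ]` with `f ∣ D f` preserves the ideal `(f)`, hence descends to
the coordinate ring. [folklore] -/
noncomputable def derivCoord (D : Derivation K (MvPolynomial σ K) (MvPolynomial σ K))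
    (hD : f ∣ D f) : Derivation K (CoordRing f) (CoordRing f) :=
  Derivation.liftOfSurjective (f := Ideal.Quotient.mkₐ K (Ideal.span {f}))
    Ideal.Quotient.mk_surjective (d := D) (by
      intro x hx
      rw [Ideal.Quotient.mkₐ_eq_mk, Ideal.Quotient.eq_zero_iff_mem, Ideal.mem_span_singleton]
        at hx ⊢
      obtain ⟨q, rfl⟩ := hx
      rw [Derivation.leibniz, smul_eq_mul, smul_eq_mul]
      exact dvd_add (dvd_mul_right f _) (dvd_mul_of_dvd_right hD q))

omit [Fact (Irreducible f)] in
/-- `derivCoord D` acts on classes by `D`. [folklore] -/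
theorem derivCoord_mk (D : Derivation K (MvPolynomial σ K) (MvPolynomial σ K)) (hD : f ∣ D f)
    (g : MvPolynomial σ K) :
    derivCoord D hD (Ideal.Quotient.mk (Ideal.span {f}) g) =
      Ideal.Quotient.mk (Ideal.span {f}) (D g) := by
  unfold derivCoord
  exact Derivation.liftOfSurjective_apply _ _ g

/-- The extension of a tangent derivation to the function field (a derivation of a domain extends
uniquely to its field of fractions). [folklore] -/
noncomputable def derivFn (D : Derivation K (MvPolynomial σ K) (MvPolynomial σ K))
    (hD : f ∣ D f) : Derivation K (FnField f) (FnField f) :=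
  (Literature.AlgebraicGeometry.Resolution.exists_derivation_extend_of_isLocalization K
    (FnField f) (nonZeroDivisors (CoordRing f)) (derivCoord D hD)).choose

/-- `derivFn D` acts on `ḡ` by `D`: `(derivFn D) ḡ = (D g)‾`. [folklore] -/
theorem derivFn_toFn (D : Derivation K (MvPolynomial σ K) (MvPolynomial σ K)) (hD : f ∣ D f)
    (g : MvPolynomial σ K) : derivFn D hD (toFn f g) = toFn f (D g) := by
  have h := (Literature.AlgebraicGeometry.Resolution.exists_derivation_extend_of_isLocalization K
    (FnField f) (nonZeroDivisors (CoordRing f)) (derivCoord D hD)).choose_spec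
    (Ideal.Quotient.mk (Ideal.span {f}) g)
  rw [toFn_apply, toFn_apply, ← derivCoord_mk D hD g]
  exact h

/-- Two `K`-derivations of the function field which agree on the coordinate functions `x̄ᵢ`
agree. [folklore] -/
theorem derivation_eq_of_forall_X {D₁ D₂ : Derivation K (FnField f) (FnField f)}
    (h : ∀ i, D₁ (toFn f (X i)) = D₂ (toFn f (X i))) : D₁ = D₂ := by
  -- agreement on `K[σ]`
  have hpoly : ∀ g : MvPolynomial σ K, D₁ (toFn f g) = D₂ (toFn f g) := by
    intro g
    induction g using MvPolynomial.induction_on with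
    | C a =>
      have hC : toFn f (C a) = algebraMap K (FnField f) a := (toFn f).commutes a
      rw [hC, Derivation.map_algebraMap, Derivation.map_algebraMap]
    | add p q hp hq => rw [map_add, map_add, map_add, hp, hq]
    | mul_X p i hp =>
      rw [map_mul, Derivation.leibniz, Derivation.leibniz, hp, h i]
  -- agreement on the coordinate ring
  have hcoord : ∀ a : CoordRing f, D₁ (algebraMap _ (FnField f) a) = D₂ (algebraMap _ _ a) := by
    intro a
    obtain ⟨g, rfl⟩ := Ideal.Quotient.mk_surjective a
    exact hpoly g
  -- fractions
  refine Derivation.ext fun x => ?_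
  obtain ⟨a, b, hb, rfl⟩ := IsFractionRing.div_surjective (A := CoordRing f) x
  have hb' : algebraMap (CoordRing f) (FnField f) b ≠ 0 :=
    IsFractionRing.to_map_ne_zero_of_mem_nonZeroDivisors hb
  rw [Derivation.leibniz_div, Derivation.leibniz_div, hcoord a, hcoord b]

end Derivations

/-! ### Symmetry of mixed partial derivatives -/

section PDeriv

variable {R : Type*} [CommRing R] {τ : Type*}

/-- Partial derivatives of polynomials commute. [folklore] -/
theorem pderiv_pderiv_comm (i j : τ) (p : MvPolynomial τ R) :
    pderiv i (pderiv j p) = pderiv j (pderiv i p) := by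
  classical
  induction p using MvPolynomial.induction_on with
  | C a => simp only [pderiv_C, map_zero]
  | add p q hp hq => simp only [map_add, hp, hq]
  | mul_X p k hp =>
    simp only [pderiv_mul, map_add, hp, pderiv_X]
    by_cases hik : i = k <;> by_cases hjk : j = k <;> simp [hik, hjk, eq_comm]

end PDeriv

/-! ### The graph derivations of a surface in `K³` -/

section Graph

variable (f : MvPolynomial (Fin 3) K) [Fact (Irreducible f)]

/-- The tangent derivation `∂₂f · ∂ₐ - ∂ₐf · ∂₂` of `K[X₀,X₁,X₂]`; it kills `f`. [folklore] -/
noncomputable def tangentDeriv (a : Fin 3) :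
    Derivation K (MvPolynomial (Fin 3) K) (MvPolynomial (Fin 3) K) :=
  pderiv 2 f • (pderiv a : Derivation K (MvPolynomial (Fin 3) K) (MvPolynomial (Fin 3) K)) -
    pderiv a f • (pderiv 2 : Derivation K (MvPolynomial (Fin 3) K) (MvPolynomial (Fin 3) K))

omit [Fact (Irreducible f)] in
/-- Unfolding `tangentDeriv`. [folklore] -/
theorem tangentDeriv_apply (a : Fin 3) (g : MvPolynomial (Fin 3) K) :
    tangentDeriv f a g = pderiv 2 f * pderiv a g - pderiv a f * pderiv 2 g := by
  simp [tangentDeriv, Derivation.sub_apply, Derivation.smul_apply, smul_eq_mul]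

omit [Fact (Irreducible f)] in
/-- `tangentDeriv f a` kills `f`. [folklore] -/
theorem tangentDeriv_self (a : Fin 3) : tangentDeriv f a f = 0 := by
  rw [tangentDeriv_apply]; ring

/-- **The graph derivations** `gD f a = (∂₂f · ∂ₐ - ∂ₐf · ∂₂)/∂₂f` (`a = 0, 1`) of the function
field: differentiation with respect to `x₀`, `x₁` along the graph `x₂ = z(x₀, x₁)` of the
surface. [folklore] -/
noncomputable def gD (a : Fin 3) : Derivation K (FnField f) (FnField f) :=
  (toFn f (pderiv 2 f))⁻¹ • derivFn (tangentDeriv f a) (by rw [tangentDeriv_self]; exact dvd_zero f)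

/-- `gD a` on `ḡ`, raw form. [folklore] -/
theorem gD_toFn_raw (a : Fin 3) (g : MvPolynomial (Fin 3) K) :
    gD f a (toFn f g) = (toFn f (pderiv 2 f))⁻¹ *
      (toFn f (pderiv 2 f) * toFn f (pderiv a g) - toFn f (pderiv a f) * toFn f (pderiv 2 g)) := by
  rw [gD, Derivation.smul_apply, derivFn_toFn, tangentDeriv_apply, smul_eq_mul, map_sub, map_mul,
    map_mul]

variable {f}

/-- `gD a (x̄₂) = -∂ₐf/∂₂f`. [folklore] -/
theorem gD_X_two (h2 : toFn f (pderiv 2 f) ≠ 0) {a : Fin 3} (ha : a ≠ 2) :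
    gD f a (toFn f (X 2)) = -(toFn f (pderiv a f) / toFn f (pderiv 2 f)) := by
  classical
  rw [gD_toFn_raw, pderiv_X, pderiv_X]
  simp [ha]
  field_simp

/-- **Chain rule**: `gD a (ḡ) = (∂ₐ g)‾ + (∂₂ g)‾ · gD a (x̄₂)`. [folklore] -/
theorem gD_toFn (h2 : toFn f (pderiv 2 f) ≠ 0) {a : Fin 3} (ha : a ≠ 2)
    (g : MvPolynomial (Fin 3) K) :
    gD f a (toFn f g) = toFn f (pderiv a g) + toFn f (pderiv 2 g) * gD f a (toFn f (X 2)) := by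
  rw [gD_X_two h2 ha, gD_toFn_raw]
  field_simp
  ring

/-- `gD a (x̄ₐ) = 1`. [folklore] -/
theorem gD_X_self (h2 : toFn f (pderiv 2 f) ≠ 0) {a : Fin 3} (ha : a ≠ 2) :
    gD f a (toFn f (X a)) = 1 := by
  classical
  rw [gD_toFn h2 ha, pderiv_X, pderiv_X]
  simp [ha]

/-- `gD a (x̄_b) = 0` for `b ≠ a`, `b ≠ 2`. [folklore] -/
theorem gD_X_of_ne (h2 : toFn f (pderiv 2 f) ≠ 0) {a b : Fin 3} (ha : a ≠ 2) (hba : b ≠ a)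
    (hb : b ≠ 2) : gD f a (toFn f (X b)) = 0 := by
  classical
  rw [gD_toFn h2 ha, pderiv_X, pderiv_X]
  simp [hba, hb]

/-- **The graph derivations commute**: `gD 0 (gD 1 u) = gD 1 (gD 0 u)` (symmetry of the mixed
partials of `f`). [folklore] -/
theorem gD_comm (h2 : toFn f (pderiv 2 f) ≠ 0) (u : FnField f) :
    gD f 0 (gD f 1 u) = gD f 1 (gD f 0 u) := by
  suffices hbr : ⁅gD f 0, gD f 1⁆ = 0 by
    have := congrArg (fun D => D u) hbr
    simp only [Derivation.commutator_apply, Derivation.zero_apply] at this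
    exact sub_eq_zero.1 this
  refine derivation_eq_of_forall_X fun i => ?_
  rw [Derivation.commutator_apply, Derivation.zero_apply]
  match i with
  | 0 =>
    simp [gD_X_self h2 (show (0 : Fin 3) ≠ 2 by decide),
      gD_X_of_ne h2 (show (1 : Fin 3) ≠ 2 by decide) (show (0 : Fin 3) ≠ 1 by decide)
        (show (0 : Fin 3) ≠ 2 by decide)]
  | 1 =>
    simp [gD_X_self h2 (show (1 : Fin 3) ≠ 2 by decide),
      gD_X_of_ne h2 (show (0 : Fin 3) ≠ 2 by decide) (show (1 : Fin 3) ≠ 0 by decide)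
        (show (1 : Fin 3) ≠ 2 by decide)]
  | 2 =>
    -- the mixed-partials identity: expand everything in terms of the partials of `f`
    classical
    simp only [gD_toFn_raw, map_sub, Derivation.leibniz, Derivation.leibniz_inv, smul_eq_mul,
      pderiv_X]
    simp only [pderiv_pderiv_comm 1 0 f, pderiv_pderiv_comm 2 0 f, pderiv_pderiv_comm 2 1 f]
    simp
    field_simp
    ring

end Graph

end Hypersurface

end Literature.RingTheory.MvPolynomial
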